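import Mathlib.Algebra.CharP.Lemmas
import Mathlib.Algebra.CharP.Two
import Mathlib.Tactic.Ring
import Mathlib.Tactic.NormNum
import HarnessLib

/-!
# Scope caveat to Hauser–Perlega's first example: the hypersurface `z⁸ + F⁰ = 0` is RATIONAL

`Literature/Barriers/ResolutionOfSingularities/ResidualOrderUnboundedExample1Rational.lean` — companion of
`ResidualOrderUnboundedExample1.lean` / `…Example1Cycle.lean` (barrier catalogue, D-0021, summit
`ResolutionOfSingularities`). Those files kernel-check Hauser–Perlega's divergent point blow-up sequence for
`f = z⁸ + F⁰`, `F⁰ = x⁴y⁴w⁸ + x⁷y⁴u¹⁰w⁶ = x⁴y⁴w⁶(w² + x³u¹⁰)` over fields of characteristic `2`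
(`HauserPerlega.Example1.F0`, `hasDivergentPointBlowupSequence_two`) [cite: HauserPerlega2019, §4].
This file records an elementary fact that sharpens the entry's `scope_caveats` (a) ("they do not
constitute a counterexample to the existence of resolutions"): **the function field of the example is
purely transcendental over `𝔽₂`**, so every place of it is locally uniformizable and the divergence of
the residual order is a property of the point-blow-up STRATEGY, not of any valuation ("kangaroo place")
followed by the run.

## The parametrisation (characteristic `2` throughout)

With free `t, r, u, v, w` put `x = r⁴/(u²w²)`, `y = t²/(w² + r³u)`, `z = r²t/(uw)`. Then `z⁸ = F⁰(x,y,u,w)`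
(`hauserPerlega_example1_param`, denominators cleared). Conversely, in `K = 𝔽₂(x,y,u,v,w,z)`, `z⁸ = F⁰`:
`s := (z⁴ + x²y²w⁴)/(x³y²u⁵w³)` satisfies `s² = x` (`hauserPerlega_example1_sqrt_x`);
`r := (z² + s²yw²)/(s³yu²w)` satisfies `r² = suw`, so `s = r²/(uw)` (`hauserPerlega_example1_r_sq`, from
`z⁴ = s⁴y²w⁴ + s⁷y²u⁵w³`, the square root of the equation); and `t := zuw/r²` satisfies
`t² = y(w² + r³u)`, so `y = t²/(w² + r³u)` (`hauserPerlega_example1_t_sq`). Hence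
`𝔽₂(x,y,u,v,w,z) = 𝔽₂(t,r,u,v,w)`: five generators of a field of transcendence degree five, i.e. `K` is a
rational function field. (Mechanism: three successive square roots; Frobenius is additive, so
`√(x⁴y⁴w⁸ + x⁷y⁴u¹⁰w⁶) = x²y²w⁴ + x³y²u⁵w³√x`, etc. — available exactly because `F⁰` is a BINOMIAL.)

## Consequences (prose; not formalised here)

* For every valuation ring `O ⊇ 𝔽₂` of `K`, the polynomial ring `𝔽₂[t^{±1}, r^{±1}, u^{±1}, v^{±1}, w^{±1}]`
  (signs chosen so that the generators lie in `O`) is a finitely generated affine model of `K` inside `O`,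
  regular at every prime: `IsLocallyUniformizable (ZMod 2) K O` holds for ALL `O`
  (cf. `Literature.AlgebraicGeometry.Resolution.isRegularRing_adjoin_of_algebraicIndependent`). In particular
  the valuations dominating every stage of the divergent run are uniformizable — off the tower.
* The same three-monomial ("trinomial", torus of rank `dim − 1`) shape is shared by the second example
  (`HauserPerlega.Example2.F0`, also a binomial); specimens with `≤ dim + 2` monomials are `T`-varieties of
  complexity `≤ 1` and cannot witness a failure of local uniformization.

## What is proved

Four polynomial identities over an arbitrary commutative ring of characteristic `2` (the last one over any
commutative ring): the parametrisation identity and the three inverse square-root steps, each cleared of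
denominators. Everything is `ring` after `(a + b)^{2^k} = a^{2^k} + b^{2^k}`.
-/

namespace Literature.Barriers.ResolutionOfSingularities

namespace HauserPerlega

namespace Example1

/-- **Hauser–Perlega's first example is rational — the parametrisation.** For `x = r⁴/(u²w²)`,
`y = t²/(w² + r³u)`, `z = r²t/(uw)` one has `z⁸ = x⁴y⁴w⁸ + x⁷y⁴u¹⁰w⁶ (= F⁰)`; multiplied through by
`(u²w²)⁷ (w² + r³u)⁴ (uw)⁸` this is the stated identity, valid in every commutative ring of
characteristic `2`. [cite: HauserPerlega2019, §4 First example (0)] -/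
theorem hauserPerlega_example1_param {R : Type*} [CommRing R] [CharP R 2] (t r u w : R) :
    (r ^ 2 * t) ^ 8 * (u ^ 2 * w ^ 2) ^ 7 * (w ^ 2 + r ^ 3 * u) ^ 4 =
      (r ^ 4) ^ 4 * (u ^ 2 * w ^ 2) ^ 3 * (t ^ 2) ^ 4 * w ^ 8 * (u * w) ^ 8 +
        (r ^ 4) ^ 7 * (t ^ 2) ^ 4 * u ^ 10 * w ^ 6 * (u * w) ^ 8 := by
  haveI : Fact (Nat.Prime 2) := ⟨Nat.prime_two⟩
  have h4 := add_pow_char_pow (w ^ 2) (r ^ 3 * u) 2 2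
  norm_num at h4
  rw [h4]
  ring

/-- First inverse step: from `z⁸ = F⁰`, `(z⁴ + x²y²w⁴)² = x·(x³y²u⁵w³)²` — the square root of `x`
lies in the function field (`s = (z⁴ + x²y²w⁴)/(x³y²u⁵w³)`, `s² = x`). [folklore] -/
theorem hauserPerlega_example1_sqrt_x {R : Type*} [CommRing R] [CharP R 2] (x y u w z : R)
    (hf : z ^ 8 = x ^ 4 * y ^ 4 * w ^ 8 + x ^ 7 * y ^ 4 * u ^ 10 * w ^ 6) :
    (z ^ 4 + x ^ 2 * y ^ 2 * w ^ 4) ^ 2 = x * (x ^ 3 * y ^ 2 * u ^ 5 * w ^ 3) ^ 2 := by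
  rw [CharTwo.add_sq, show (z ^ 4) ^ 2 = z ^ 8 by ring, hf,
    show (x ^ 2 * y ^ 2 * w ^ 4) ^ 2 = x ^ 4 * y ^ 4 * w ^ 8 by ring,
    add_comm (x ^ 4 * y ^ 4 * w ^ 8) _, add_assoc, CharTwo.add_self_eq_zero, add_zero]
  ring

/-- Second inverse step: with `x = s²` the square root of the equation reads
`z⁴ = s⁴y²w⁴ + s⁷y²u⁵w³`, and then `(z² + s²yw²)² = (suw)·(s³yu²w)²` — i.e. `r² = suw` for
`r = (z² + s²yw²)/(s³yu²w)`. [folklore] -/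
theorem hauserPerlega_example1_r_sq {R : Type*} [CommRing R] [CharP R 2] (s y u w z : R)
    (ha : z ^ 4 = s ^ 4 * y ^ 2 * w ^ 4 + s ^ 7 * y ^ 2 * u ^ 5 * w ^ 3) :
    (z ^ 2 + s ^ 2 * y * w ^ 2) ^ 2 = (s * u * w) * (s ^ 3 * y * u ^ 2 * w) ^ 2 := by
  rw [CharTwo.add_sq, show (z ^ 2) ^ 2 = z ^ 4 by ring, ha,
    show (s ^ 2 * y * w ^ 2) ^ 2 = s ^ 4 * y ^ 2 * w ^ 4 by ring,
    add_comm (s ^ 4 * y ^ 2 * w ^ 4) _, add_assoc, CharTwo.add_self_eq_zero, add_zero]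
  ring

/-- Third inverse step: with `suw = r²` and the square root of the previous equation,
`z² = s²yw² + s³yu²w·r`, one gets `z²u²w² = r⁴yw² + r⁷yu`, i.e. `t² = y(w² + r³u)` for
`t = zuw/r²` (any commutative ring). [folklore] -/
theorem hauserPerlega_example1_t_sq {R : Type*} [CommRing R] (r s y u w z : R)
    (hs : s * u * w = r ^ 2) (hb : z ^ 2 = s ^ 2 * y * w ^ 2 + s ^ 3 * y * u ^ 2 * w * r) :
    z ^ 2 * u ^ 2 * w ^ 2 = r ^ 4 * y * w ^ 2 + r ^ 7 * y * u := by
  have h1 : s ^ 2 * u ^ 2 * w ^ 2 = r ^ 4 := by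
    rw [show s ^ 2 * u ^ 2 * w ^ 2 = (s * u * w) ^ 2 by ring, hs]; ring
  have h2 : s ^ 3 * u ^ 4 * w ^ 3 = r ^ 6 * u := by
    rw [show s ^ 3 * u ^ 4 * w ^ 3 = (s * u * w) ^ 3 * u by ring, hs]; ring
  calc z ^ 2 * u ^ 2 * w ^ 2
      = (s ^ 2 * u ^ 2 * w ^ 2) * y * w ^ 2 + (s ^ 3 * u ^ 4 * w ^ 3) * y * r := by rw [hb]; ring
    _ = r ^ 4 * y * w ^ 2 + r ^ 7 * y * u := by rw [h1, h2]; ring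

end Example1

end HauserPerlega

end Literature.Barriers.ResolutionOfSingularities
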